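import Literature.NumberTheory.GaloisRepresentations.IdeleClassBarAbsoluteGaloisTransport
import Literature.Algebra.Homology.DiscreteRepInflTrivLayers
import HarnessLib

/-!
# Milne's (b) for `(U_L, Res C̄)`, surjectivity: every additive functional on `Ext¹_{C_{U_L}}(ℤ, ℤ/m)` is
# `χ ↦ inv_U (Inf (H²(id, φ_V) (β_m χ)))` on the trace-layer characters for ONE invariant vector `φ`
# (Tate C–F VII §11.3 + §5.1 (D), existence theorem; Milne ADT I Thm. 1.8 (b))

Topic `NumberTheory/GaloisRepresentations`; namespace `Literature.NumberTheory.GaloisRepresentations.IdeleClassBar`.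
Sequel to door-c4 g16's `IdeleClassBarModPairingArtin.lean` (B3: the layer pairing values of `(U_L, Res C̄)` are
door-c6's `classInvAll L E (baseCup x (β_m [χ ∘ g]))`), `IdeleClassBarModAlphaOneInjective.lean` (injectivity side,
`GalLayer.exists_ge_nonempty_algHom`), door-c6 g14's `IdeleClassAlphaOneLayers.lean`
(`exists_idele_forall_layer_pairing_eq`: over the base `L`, every additive family `Φ_K` on the characters of the finite
abelian `K ⊆ L̄`, compatible under THE restrictions `Γ_L → Gal(K/L)`, is `χ ↦ −m·inv_{K/L}(ι[x] ∪ β_m[χ])` for ONE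
idèle `x`), and door-c4 g17's `IdeleClassBarAbsoluteGaloisTransport.lean` (`U_L ≃* Γ_L` compatible with restriction
to abelian `K`; characters of `Gal(E/L)` factor through abelian `K ⊆ L̄`) / `DiscreteRepInflTrivLayers.lean`
(inflated degree-one classes are determined by their character on `U_L`).  Definitions with bodies (`layerCharClass`)
and theorems; NO named fact, no instance, no notation, no `sorry`.

THE POINT (`exists_hom_forall_layer_value_eq`).  Let `U = U_L` and `Ψ : Ext¹_{C_U}(ℤ, ℤ/m) → ℚ/ℤ` additive.  For a
finite abelian `K ⊆ L̄` and `χ_K : Gal(K/L) → ℤ/m`, embed `K` over `L` into a layer `M ⊇ L` of `F̄` and let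
`layerCharClass` be the inflated class of the character `χ_K ∘ res : Gal(M/L) ≅ U_L ⧸ (U_M ∩ U_L) → ℤ/m`; it does not
depend on the choices (`layerCharClass_eq_of_forall`: its character on `U_L` is `u ↦ χ_K((θ u θ⁻¹)|_K)`,
`absRestrictNormalHom_absGalEquiv`), is additive in `χ_K` and `m`-torsion.  So `Φ_K χ_K := (−Ψ(layerCharClass))·m ∈ ℤ/m`
is an additive compatible family, door-c6's theorem gives an idèle `x₀` of `L` with
`Ψ(layerCharClass) = inv_{K/L}(ι[x₀] ∪ β_m[χ_K])` for all abelian `K`, and `φ` is the invariant vector of the class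
`x̄₀ ∈ C_L = C̄^{U_L}` (door-c4 `homTrivEquiv`).  For a layer `E ⊋ L` and `χ ∈ H¹(U_L ⧸ (U_E ∩ U_L), ℤ/m)` the character
`χ ∘ g` of `Gal(E/L)` factors through an abelian `K ⊆ L̄` embedded in `E` (`exists_isAbelianGalois_character_factor`), so
`inflTriv (E⁻¹ χ) = layerCharClass` and `Ψ(inflTriv (E⁻¹ χ)) = inv_{K/L}(ι[x₀] ∪ β_m[χ_K]) = inv_{E/L}(ι[x₀] ∪ β_m[χ ∘ g])`
(door-c6's inflation invariance `classInvAll_baseCup_bockstein_comp`) `=` the layer pairing value of `φ` (B3); the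
degenerate layer `E = L` carries only `χ = 0`.

HONEST FRAMING: bookkeeping over door-c6 g14's class field theory (existence theorem + reciprocity); no case of BSD
or of Poitou–Tate is proved.  Route A (A5)-ARITH of crux `AnticycControlAdditiveK` (item 19295, cell bsd-schneider),
seat door-c4 gen 17: this is the hypothesis `Hsurj` of door-c4 g16's `adjointSurjective_triv_zmod_of_cofinal` for
`(U_L, Res C̄)` and the trace layers.

## References
* J. S. Milne, *Arithmetic Duality Theorems* (2nd ed. 2006), I §1 Theorem 1.8 (b). [MilneADT2006]
* J. W. S. Cassels, A. Fröhlich (eds.), *Algebraic Number Theory* (1967), Ch. VII (J. Tate) §5.1 (D), §11.1, §11.3.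
  [CasselsFrohlichANT1967]
* J. Neukirch, *Class Field Theory — The Bonn Lectures* (2013), Part III Thm. (7.12). [Neukirch2013]
-/

noncomputable section

-- as in door-c6's `IdeleClassCharacterPairing*` / door-c4 g16's files: Bockstein classes across the definitionally
-- equal objects `(intModShortComplex G m).Xᵢ = Rep.trivial ℤ G _`
set_option backward.isDefEq.respectTransparency false

open NumberField CategoryTheory CategoryTheory.Abelian groupCohomology
open Field (absoluteGaloisGroup)
open Literature.NumberTheory.Automorphic Literature.NumberTheory.Automorphic.IdeleClassGroup
open Literature.NumberTheory.NumberFields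
open Literature.Algebra.Homology Literature.Algebra.Homology.DiscreteRep
open Literature.AnabelianGeometry.AbsoluteAnabelian.Prop121vii (zmodToQmodZ zmodToQmodZ_injective)
open scoped Classical

namespace Literature.NumberTheory.GaloisRepresentations

namespace IdeleClassBar

variable {F : Type} [Field F] [NumberField F] {L E M M' : GalLayer F}

/-! ## §39. `traceCharacter` is inverse to `galCharacter` and additive -/

omit [NumberField F] in
/-- `traceCharacter (galCharacter χ) = χ`: every class of `H¹(U_L ⧸ (U_E ∩ U_L), ℤ/m)` is the class of its character
`χ ∘ g` of `Gal(E/L)`. [cite: Brown1982CohomologyGroups, III §8] -/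
theorem traceCharacter_galCharacter (h : L ≤ E) {m : ℕ}
    (χ : groupCohomology (Rep.trivial ℤ ((L.openNormalSubgroup : Subgroup (absoluteGaloisGroup F)) ⧸
        (traceOpenNormalSubgroup (L.openNormalSubgroup : Subgroup (absoluteGaloisGroup F)) E.openNormalSubgroup :
          Subgroup (L.openNormalSubgroup : Subgroup (absoluteGaloisGroup F)))) (ZMod m)) 1) :
    traceCharacter h (galCharacter h χ) = χ := by
  rw [traceCharacter, galCharacter, AddMonoidHom.comp_assoc]
  have hcomp : (MonoidHom.toAdditive (galToTraceQuot h)).comp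
      (MonoidHom.toAdditive (galTraceQuotEquiv h).symm.toMonoidHom) = AddMonoidHom.id _ :=
    AddMonoidHom.ext fun q => by
      change Additive.ofMul (galToTraceQuot h ((galTraceQuotEquiv h).symm (Additive.toMul q))) = q
      rw [← galTraceQuotEquiv_apply, MulEquiv.apply_symm_apply]
      rfl
  rw [hcomp, AddMonoidHom.comp_id, Iso.hom_inv_id_apply]

omit [NumberField F] in
/-- `traceCharacter` is additive. [cite: Brown1982CohomologyGroups, III §8] -/
theorem traceCharacter_add (h : L ≤ E) {m : ℕ}
    (χ₀ χ₀' : Additive (letI := GalLayer.algebraOfLE h; (E.1 ≃ₐ[L.1] E.1)) →+ ZMod m) :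
    traceCharacter h (χ₀ + χ₀') = traceCharacter h χ₀ + traceCharacter h χ₀' := by
  rw [traceCharacter, traceCharacter, traceCharacter, AddMonoidHom.add_comp, map_add]

omit [NumberField F] in
/-- `traceCharacter 0 = 0`. [cite: Brown1982CohomologyGroups, III §8] -/
theorem traceCharacter_zero (h : L ≤ E) {m : ℕ} :
    traceCharacter h (0 : Additive (letI := GalLayer.algebraOfLE h; (E.1 ≃ₐ[L.1] E.1)) →+ ZMod m) = 0 := by
  rw [traceCharacter, AddMonoidHom.zero_comp, map_zero]

omit [NumberField F] in
/-- **The degenerate layer `E = L` carries only the zero class**: `H¹(U_L ⧸ (U_L ∩ U_L), ℤ/m) = 0` (the Galois group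
`Gal(L/L)` is trivial). [cite: CasselsFrohlichANT1967, Ch. VII §11.1] -/
theorem traceLayer_class_eq_zero_of_eq (h : L ≤ E) (hLE : L = E) {m : ℕ}
    (χ : groupCohomology (Rep.trivial ℤ ((L.openNormalSubgroup : Subgroup (absoluteGaloisGroup F)) ⧸
        (traceOpenNormalSubgroup (L.openNormalSubgroup : Subgroup (absoluteGaloisGroup F)) E.openNormalSubgroup :
          Subgroup (L.openNormalSubgroup : Subgroup (absoluteGaloisGroup F)))) (ZMod m)) 1) :
    χ = 0 := by
  haveI := GalLayer.subsingleton_algEquiv_of_eq h hLE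
  have hχ : galCharacter h χ = 0 := AddMonoidHom.ext fun σ => by
    have hσ : σ = 0 := congrArg Additive.ofMul (Subsingleton.elim (Additive.toMul σ) 1)
    rw [AddMonoidHom.zero_apply, hσ, map_zero]
  rw [← traceCharacter_galCharacter h χ, hχ, traceCharacter_zero]

/-! ## §40. The inflated class of a character of `K` embedded in a layer `M ⊇ L` -/

/-- **The class in `Ext¹_{C_{U_L}}(ℤ, ℤ/m)` of a character `χ_K : Gal(K/L) → ℤ/m` of a normal `K/L` embedded over `L`
into a layer `M ⊇ L` by `ψ`**: the inflation from the trace layer `U_L ⧸ (U_M ∩ U_L) ≅ Gal(M/L)` of the class of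
`χ_K ∘ res_K : Gal(M/L) → ℤ/m` (door-c4 g16 `traceCharacter`, `inflTriv`). [cite: MilneADT2006, I Theorem 1.8 (b)]
[cite: CasselsFrohlichANT1967, Ch. VII §11.1] -/
def layerCharClass (h : L ≤ M) {K : Type} [Field K] [Algebra L.1 K] [Normal L.1 K]
    (ψ : letI := GalLayer.algebraOfLE h; K →ₐ[L.1] M.1) {m : ℕ} (χK : Additive (K ≃ₐ[L.1] K) →+ ZMod m) :
    Ext ((infFunctor ℤ (traceOpenNormalSubgroup (L.openNormalSubgroup : Subgroup (absoluteGaloisGroup F))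
        M.openNormalSubgroup : Subgroup (L.openNormalSubgroup : Subgroup (absoluteGaloisGroup F)))
        (LayerColimit.coe_isOpen _)).obj (Rep.trivial ℤ _ ℤ))
      (triv (k := ℤ) (Γ := (L.openNormalSubgroup : Subgroup (absoluteGaloisGroup F))) (ZMod m)) 1 :=
  letI := GalLayer.algebraOfLE h
  letI : Algebra K M.1 := ψ.toRingHom.toAlgebra
  haveI : IsScalarTower L.1 K M.1 := IsScalarTower.of_algebraMap_eq fun r => (ψ.commutes r).symm
  inflTriv (traceOpenNormalSubgroup (L.openNormalSubgroup : Subgroup (absoluteGaloisGroup F)) M.openNormalSubgroup :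
      Subgroup (L.openNormalSubgroup : Subgroup (absoluteGaloisGroup F))) (LayerColimit.coe_isOpen _)
    ((RepExt.extTrivialAddEquivGroupCohomology (Rep.trivial ℤ _ (ZMod m)) 1).symm
      (traceCharacter h (χK.comp (MonoidHom.toAdditive (AlgEquiv.restrictNormalHom K)))))

omit [NumberField F] in
/-- Formula. [cite: MilneADT2006, I Theorem 1.8 (b)] -/
theorem layerCharClass_def (h : L ≤ M) {K : Type} [Field K] [Algebra L.1 K] [Normal L.1 K]
    (ψ : letI := GalLayer.algebraOfLE h; K →ₐ[L.1] M.1) {m : ℕ} (χK : Additive (K ≃ₐ[L.1] K) →+ ZMod m) :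
    layerCharClass h ψ χK =
      letI := GalLayer.algebraOfLE h
      letI : Algebra K M.1 := ψ.toRingHom.toAlgebra
      haveI : IsScalarTower L.1 K M.1 := IsScalarTower.of_algebraMap_eq fun r => (ψ.commutes r).symm
      inflTriv (traceOpenNormalSubgroup (L.openNormalSubgroup : Subgroup (absoluteGaloisGroup F)) M.openNormalSubgroup :
          Subgroup (L.openNormalSubgroup : Subgroup (absoluteGaloisGroup F))) (LayerColimit.coe_isOpen _)
        ((RepExt.extTrivialAddEquivGroupCohomology (Rep.trivial ℤ _ (ZMod m)) 1).symm
          (traceCharacter h (χK.comp (MonoidHom.toAdditive (AlgEquiv.restrictNormalHom K))))) :=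
  rfl

omit [NumberField F] in
/-- `layerCharClass` is additive in the character. [cite: MilneADT2006, I Theorem 1.8 (b)] -/
theorem layerCharClass_add (h : L ≤ M) {K : Type} [Field K] [Algebra L.1 K] [Normal L.1 K]
    (ψ : letI := GalLayer.algebraOfLE h; K →ₐ[L.1] M.1) {m : ℕ} (χK χK' : Additive (K ≃ₐ[L.1] K) →+ ZMod m) :
    layerCharClass h ψ (χK + χK') = layerCharClass h ψ χK + layerCharClass h ψ χK' := by
  rw [layerCharClass_def, layerCharClass_def, layerCharClass_def, AddMonoidHom.add_comp, traceCharacter_add, map_add,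
    inflTriv_add]

omit [NumberField F] in
/-- **`m • Ψ (layerCharClass h ψ χ_K) = 0`** for every additive `Ψ` (the class is that of a `ℤ/m`-character).
[cite: MilneADT2006, I Lemma 1.7] -/
theorem nsmul_apply_layerCharClass_eq_zero (h : L ≤ M) {K : Type} [Field K] [Algebra L.1 K] [Normal L.1 K]
    (ψ : letI := GalLayer.algebraOfLE h; K →ₐ[L.1] M.1) {m : ℕ} (χK : Additive (K ≃ₐ[L.1] K) →+ ZMod m)
    {Q : Type} [AddCommGroup Q]
    (Ψ : Ext (triv (k := ℤ) (Γ := (L.openNormalSubgroup : Subgroup (absoluteGaloisGroup F))) ℤ)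
      (triv (k := ℤ) (Γ := (L.openNormalSubgroup : Subgroup (absoluteGaloisGroup F))) (ZMod m)) 1 →+ Q) :
    m • Ψ (layerCharClass h ψ χK) = 0 :=
  nsmul_apply_inflTriv_H1IsoOfIsTrivial_inv_eq_zero Ψ _ _

omit [NumberField F] in
/-- **`layerCharClass` only depends on the character `u ↦ χ_K((u|_M)|_K)` of `U_L`**: two characters `χ_K`, `χ_K'` of
normal `K, K'` embedded into layers `M, M' ⊇ L` with `χ_K((u|_M)|_K) = χ_K'((u|_{M'})|_{K'})` for all `u ∈ U_L` have the
same class (door-c4 g17 `inflTriv_H1IsoOfIsTrivial_inv_eq_of_forall`; `u|_M = (galTraceQuotEquiv h)⁻¹ [u]`).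
[cite: SerreGaloisCohomology1997, I §2.2 Proposition 8][cite: MilneADT2006, I Theorem 1.8 (b)] -/
theorem layerCharClass_eq_of_forall (h : L ≤ M) (h' : L ≤ M') {K K' : Type} [Field K] [Algebra L.1 K] [Normal L.1 K]
    [Field K'] [Algebra L.1 K'] [Normal L.1 K']
    (ψ : letI := GalLayer.algebraOfLE h; K →ₐ[L.1] M.1) (ψ' : letI := GalLayer.algebraOfLE h'; K' →ₐ[L.1] M'.1) {m : ℕ}
    (χK : Additive (K ≃ₐ[L.1] K) →+ ZMod m) (χK' : Additive (K' ≃ₐ[L.1] K') →+ ZMod m)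
    (H : ∀ u : (L.openNormalSubgroup : Subgroup (absoluteGaloisGroup F)),
      (letI := GalLayer.algebraOfLE h; letI : Algebra K M.1 := ψ.toRingHom.toAlgebra;
        haveI : IsScalarTower L.1 K M.1 := IsScalarTower.of_algebraMap_eq fun r => (ψ.commutes r).symm;
        χK (Additive.ofMul (AlgEquiv.restrictNormalHom K ((galTraceQuotEquiv h).symm (QuotientGroup.mk u))))) =
      (letI := GalLayer.algebraOfLE h'; letI : Algebra K' M'.1 := ψ'.toRingHom.toAlgebra;
        haveI : IsScalarTower L.1 K' M'.1 := IsScalarTower.of_algebraMap_eq fun r => (ψ'.commutes r).symm;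
        χK' (Additive.ofMul (AlgEquiv.restrictNormalHom K' ((galTraceQuotEquiv h').symm (QuotientGroup.mk u)))))) :
    layerCharClass h ψ χK = layerCharClass h' ψ' χK' := by
  rw [layerCharClass_def, layerCharClass_def, traceCharacter, traceCharacter]
  exact inflTriv_H1IsoOfIsTrivial_inv_eq_of_forall _ _ _ _ fun u => H u

omit [NumberField F] in
/-- **`inflTriv (E⁻¹ χ) = layerCharClass h ψ χ_K`** when the character `χ ∘ g` of `Gal(E/L)` factors as `χ_K ∘ res_K`
through `ψ : K → E`. [cite: MilneADT2006, I Theorem 1.8 (b)] -/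
theorem inflTriv_eq_layerCharClass (h : L ≤ E) {K : Type} [Field K] [Algebra L.1 K] [Normal L.1 K]
    (ψ : letI := GalLayer.algebraOfLE h; K →ₐ[L.1] E.1) {m : ℕ} (χK : Additive (K ≃ₐ[L.1] K) →+ ZMod m)
    (χ : groupCohomology (Rep.trivial ℤ ((L.openNormalSubgroup : Subgroup (absoluteGaloisGroup F)) ⧸
        (traceOpenNormalSubgroup (L.openNormalSubgroup : Subgroup (absoluteGaloisGroup F)) E.openNormalSubgroup :
          Subgroup (L.openNormalSubgroup : Subgroup (absoluteGaloisGroup F)))) (ZMod m)) 1)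
    (hfac : letI := GalLayer.algebraOfLE h; letI : Algebra K E.1 := ψ.toRingHom.toAlgebra;
      haveI : IsScalarTower L.1 K E.1 := IsScalarTower.of_algebraMap_eq fun r => (ψ.commutes r).symm;
      galCharacter h χ = χK.comp (MonoidHom.toAdditive (AlgEquiv.restrictNormalHom K))) :
    inflTriv (traceOpenNormalSubgroup (L.openNormalSubgroup : Subgroup (absoluteGaloisGroup F)) E.openNormalSubgroup :
          Subgroup (L.openNormalSubgroup : Subgroup (absoluteGaloisGroup F))) (LayerColimit.coe_isOpen _)
        ((RepExt.extTrivialAddEquivGroupCohomology (Rep.trivial ℤ _ (ZMod m)) 1).symm χ) =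
      layerCharClass h ψ χK := by
  rw [layerCharClass_def, ← hfac, traceCharacter_galCharacter]

omit [NumberField F] in
/-- **The class of `(K, χ_K)` does not depend on the layer and the embedding, and agrees for compatible characters**:
for finite ABELIAN `K, K' ⊆ L̄` embedded in layers `M, M' ⊇ L` and characters with
`χ_K(γ|_K) = χ_K'(γ|_{K'})` for all `γ ∈ Γ_L` (THE restrictions `absRestrictNormalHom`), the classes coincide
(`layerCharClass_eq_of_forall` + door-c4 g17 `absRestrictNormalHom_absGalEquiv`: `(u|_M)|_K = (θ u θ⁻¹)|_K`).
[cite: MilneADT2006, I Theorem 1.8 (b)][cite: CasselsFrohlichANT1967, Ch. VII §11.1] -/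
theorem layerCharClass_eq_of_forall_absRestrictNormalHom (h : L ≤ M) (h' : L ≤ M')
    (K K' : IntermediateField L.1 (AlgebraicClosure L.1)) [IsAbelianGalois L.1 K] [IsAbelianGalois L.1 K']
    (ψ : letI := GalLayer.algebraOfLE h; K →ₐ[L.1] M.1) (ψ' : letI := GalLayer.algebraOfLE h'; K' →ₐ[L.1] M'.1) {m : ℕ}
    (χK : Additive (K ≃ₐ[L.1] K) →+ ZMod m) (χK' : Additive (K' ≃ₐ[L.1] K') →+ ZMod m)
    (hγ : ∀ γ : absoluteGaloisGroup L.1,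
      χK (Additive.ofMul (absRestrictNormalHom K γ)) = χK' (Additive.ofMul (absRestrictNormalHom K' γ))) :
    layerCharClass h ψ χK = layerCharClass h' ψ' χK' := by
  refine layerCharClass_eq_of_forall h h' ψ ψ' χK χK' fun u => ?_
  have e₁ := congrArg (fun τ => χK (Additive.ofMul τ)) (absRestrictNormalHom_absGalEquiv h u K ψ)
  have e₂ := congrArg (fun τ => χK' (Additive.ofMul τ)) (absRestrictNormalHom_absGalEquiv h' u K' ψ')
  exact e₁.symm.trans ((hγ (L.absGalEquiv u)).trans e₂)

/-! ## §41. The final verification at a genuine layer `E ⊋ L` -/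

set_option synthInstance.maxHeartbeats 100000 in
set_option maxHeartbeats 800000 in
-- instance synthesis over `K ⊆ L̄` and the big unfolded layer terms (as in door-c4 g16's injectivity file)
/-- **At a layer `E ⊋ L`: `inv_{K/L}(ι[x₀] ∪ β_m[χ_K]) =` the layer pairing value of `φ` at `χ`**, when `χ ∘ g = χ_K ∘ res_K`
for an abelian `K ⊆ L̄` embedded by `ψ : K → E` and `φ(1) = x̄₀` (door-c6's inflation invariance
`classInvAll_baseCup_bockstein_comp`, door-c4 g16's B3 `layerPairingValue_eq_classInvAll_baseCup` with `x_E = ι[x₀]`).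
[cite: CasselsFrohlichANT1967, Ch. VII §11.2 (bis), §11.3][cite: MilneADT2006, I Theorem 1.8 (b)] -/
theorem classInvAll_baseCup_eq_layerValue_of_factor (h : L ≤ E) (hne : L ≠ E) {m : ℕ} (hm : 0 < m)
    (φ : triv (k := ℤ) (Γ := (L.openNormalSubgroup : Subgroup (absoluteGaloisGroup F))) ℤ ⟶
      (resD ℤ (L.openNormalSubgroup : Subgroup (absoluteGaloisGroup F))).obj (classData F).toSystem.toD)
    (x₀ : haveI := L.numberField; ideleGroup L.1)
    (hx₀ : haveI := L.numberField;
      ofLayer F L (Additive.ofMul (x₀ : IdeleClassGroup L.1)) = φ.hom.hom (1 : ℤ))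
    (χ : groupCohomology (Rep.trivial ℤ ((L.openNormalSubgroup : Subgroup (absoluteGaloisGroup F)) ⧸
        (traceOpenNormalSubgroup (L.openNormalSubgroup : Subgroup (absoluteGaloisGroup F)) E.openNormalSubgroup :
          Subgroup (L.openNormalSubgroup : Subgroup (absoluteGaloisGroup F)))) (ZMod m)) 1)
    (K : haveI := L.numberField; IntermediateField L.1 (AlgebraicClosure L.1))
    (hK : haveI := L.numberField; FiniteDimensional L.1 K) (hab : haveI := L.numberField; IsAbelianGalois L.1 K)
    (ψ : letI := GalLayer.algebraOfLE h; K →ₐ[L.1] E.1) (χK : Additive (K ≃ₐ[L.1] K) →+ ZMod m)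
    (hfac : letI := GalLayer.algebraOfLE h; letI : Algebra K E.1 := ψ.toRingHom.toAlgebra;
      haveI : IsScalarTower L.1 K E.1 := IsScalarTower.of_algebraMap_eq fun r => (ψ.commutes r).symm;
      galCharacter h χ = χK.comp (MonoidHom.toAdditive (AlgEquiv.restrictNormalHom K))) :
    haveI := L.numberField; haveI : NumberField K := NumberField.of_module_finite L.1 K; haveI : NeZero m := ⟨hm.ne'⟩
    IdeleCohomology.classInvAll L.1 K (IdeleCohomology.baseCup (E := K) x₀
      (groupCohomology.δ (Bockstein.intModShortComplex_shortExact (K ≃ₐ[L.1] K) m) 1 2 rfl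
        ((H1IsoOfIsTrivial (Rep.trivial ℤ (K ≃ₐ[L.1] K) (ZMod m))).inv χK))) =
      classBarInvAt F (L.openNormalSubgroup : Subgroup (absoluteGaloisGroup F)) (LayerColimit.coe_isOpen _)
        (LayerColimit.inflG
          (traceOpenNormalSubgroup (L.openNormalSubgroup : Subgroup (absoluteGaloisGroup F)) E.openNormalSubgroup)
          ((resD ℤ (L.openNormalSubgroup : Subgroup (absoluteGaloisGroup F))).obj (classData F).toSystem.toD) 2
          (groupCohomology.map (MonoidHom.id _)
            (LayerColimit.homToLayer
              (traceOpenNormalSubgroup (L.openNormalSubgroup : Subgroup (absoluteGaloisGroup F)) E.openNormalSubgroup :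
                Subgroup (L.openNormalSubgroup : Subgroup (absoluteGaloisGroup F)))
              ((resD ℤ (L.openNormalSubgroup : Subgroup (absoluteGaloisGroup F))).obj (classData F).toSystem.toD) φ) 2
            (groupCohomology.δ (Bockstein.intModShortComplex_shortExact
              ((L.openNormalSubgroup : Subgroup (absoluteGaloisGroup F)) ⧸
                (traceOpenNormalSubgroup (L.openNormalSubgroup : Subgroup (absoluteGaloisGroup F)) E.openNormalSubgroup :
                  Subgroup (L.openNormalSubgroup : Subgroup (absoluteGaloisGroup F)))) m) 1 2 rfl χ))) := by
  haveI : NeZero m := ⟨hm.ne'⟩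
  haveI := L.numberField
  haveI := hK
  letI := GalLayer.algebraOfLE h
  haveI := GalLayer.isScalarTower_of_le h
  haveI := E.numberField
  haveI := E.isGalois
  haveI : IsGalois L.1 E.1 := IsGalois.tower_top_of_isGalois F L.1 E.1
  -- the layer fact (before the instances of `K ⊆ L̄` enter the context)
  have hB3 := layerPairingValue_eq_classInvAll_baseCup h hm φ χ x₀ (coe_baseInvariant_eq_layerVector_of_ne h hne φ x₀ hx₀)
  haveI := hab
  haveI : NumberField K := NumberField.of_module_finite L.1 K
  letI : Algebra K E.1 := ψ.toRingHom.toAlgebra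
  haveI : IsScalarTower L.1 K E.1 := IsScalarTower.of_algebraMap_eq fun r => (ψ.commutes r).symm
  rw [← IdeleCohomology.classInvAll_baseCup_bockstein_comp L.1 K E.1 m χK x₀]
  have hfac' : χK.comp (MonoidHom.toAdditive (AlgEquiv.restrictNormalHom (F := L.1) (K₁ := E.1) K)) =
      galCharacter h χ := hfac.symm
  rw [hfac']
  exact hB3.symm

/-! ## §42. Surjectivity: every additive functional on `Ext¹_{C_{U_L}}(ℤ, ℤ/m)` is represented by an invariant vector -/

set_option maxHeartbeats 800000 in
-- the big unfolded layer terms (as in door-c4 g16's injectivity file)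
/-- **The layer identity at `E ⊇ L`, given the arithmetic input on the abelian layers.**  If the idèle `x₀` of `L`
(with `φ(1) = x̄₀`) satisfies `Ψ(layerCharClass) = inv_{K/L}(ι[x₀] ∪ β_m[χ_K])` for every finite abelian `K ⊆ L̄` and
every `χ_K` (classes taken through the chosen embeddings `ψof K : K → Mof K ⊇ L`), then
`Ψ (inflTriv (E⁻¹ χ)) = inv_U (Inf (H²(id, φ_V) (β_m χ)))` for every layer `E ⊇ L` and every
`χ ∈ H¹(U_L ⧸ (U_E ∩ U_L), ℤ/m)`: for `E = L` both sides vanish (`traceLayer_class_eq_zero_of_eq`); for `E ⊋ L` the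
character `χ ∘ g` factors through an abelian `K ⊆ L̄` embedded in `E` (`exists_isAbelianGalois_character_factor`),
`inflTriv (E⁻¹ χ)` is the class of `(K, χ_K)` for EITHER embedding (`layerCharClass_eq_of_forall`,
`absRestrictNormalHom_absGalEquiv`), and §41 applies. [cite: MilneADT2006, I Theorem 1.8 (b)]
[cite: CasselsFrohlichANT1967, Ch. VII §11.3] -/
theorem apply_inflTriv_eq_layerValue (h : L ≤ E) {m : ℕ} (hm : 0 < m)
    (Ψ : Ext (triv (k := ℤ) (Γ := (L.openNormalSubgroup : Subgroup (absoluteGaloisGroup F))) ℤ)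
      (triv (k := ℤ) (Γ := (L.openNormalSubgroup : Subgroup (absoluteGaloisGroup F))) (ZMod m)) 1 →+ AddCircle (1 : ℚ))
    (φ : triv (k := ℤ) (Γ := (L.openNormalSubgroup : Subgroup (absoluteGaloisGroup F))) ℤ ⟶
      (resD ℤ (L.openNormalSubgroup : Subgroup (absoluteGaloisGroup F))).obj (classData F).toSystem.toD)
    (x₀ : haveI := L.numberField; ideleGroup L.1)
    (hx₀ : haveI := L.numberField;
      ofLayer F L (Additive.ofMul (x₀ : IdeleClassGroup L.1)) = φ.hom.hom (1 : ℤ))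
    (Mof : haveI := L.numberField;
      ∀ K : IntermediateField L.1 (AlgebraicClosure L.1), FiniteDimensional L.1 K → GalLayer F)
    (hMof : haveI := L.numberField;
      ∀ (K : IntermediateField L.1 (AlgebraicClosure L.1)) (hK : FiniteDimensional L.1 K), L ≤ Mof K hK)
    (ψof : haveI := L.numberField;
      ∀ (K : IntermediateField L.1 (AlgebraicClosure L.1)) (hK : FiniteDimensional L.1 K),
        letI := GalLayer.algebraOfLE (hMof K hK); K →ₐ[L.1] (Mof K hK).1)
    (hΨ : haveI := L.numberField; haveI : NeZero m := ⟨hm.ne'⟩;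
      ∀ (K : IntermediateField L.1 (AlgebraicClosure L.1)) (hK : FiniteDimensional L.1 K)
        (_ : IsAbelianGalois L.1 K) (χK : Additive (K ≃ₐ[L.1] K) →+ ZMod m),
        haveI : NumberField K := NumberField.of_module_finite L.1 K
        Ψ (layerCharClass (hMof K hK) (ψof K hK) χK) =
          IdeleCohomology.classInvAll L.1 K (IdeleCohomology.baseCup (E := K) x₀
            (groupCohomology.δ (Bockstein.intModShortComplex_shortExact (K ≃ₐ[L.1] K) m) 1 2 rfl
              ((H1IsoOfIsTrivial (Rep.trivial ℤ (K ≃ₐ[L.1] K) (ZMod m))).inv χK))))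
    (χ : groupCohomology (Rep.trivial ℤ ((L.openNormalSubgroup : Subgroup (absoluteGaloisGroup F)) ⧸
        (traceOpenNormalSubgroup (L.openNormalSubgroup : Subgroup (absoluteGaloisGroup F)) E.openNormalSubgroup :
          Subgroup (L.openNormalSubgroup : Subgroup (absoluteGaloisGroup F)))) (ZMod m)) 1) :
    haveI : NeZero m := ⟨hm.ne'⟩
    Ψ (inflTriv (traceOpenNormalSubgroup (L.openNormalSubgroup : Subgroup (absoluteGaloisGroup F)) E.openNormalSubgroup :
            Subgroup (L.openNormalSubgroup : Subgroup (absoluteGaloisGroup F))) (LayerColimit.coe_isOpen _)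
          ((RepExt.extTrivialAddEquivGroupCohomology (Rep.trivial ℤ _ (ZMod m)) 1).symm χ)) =
      classBarInvAt F (L.openNormalSubgroup : Subgroup (absoluteGaloisGroup F)) (LayerColimit.coe_isOpen _)
        (LayerColimit.inflG
          (traceOpenNormalSubgroup (L.openNormalSubgroup : Subgroup (absoluteGaloisGroup F)) E.openNormalSubgroup)
          ((resD ℤ (L.openNormalSubgroup : Subgroup (absoluteGaloisGroup F))).obj (classData F).toSystem.toD) 2
          (groupCohomology.map (MonoidHom.id _)
            (LayerColimit.homToLayer
              (traceOpenNormalSubgroup (L.openNormalSubgroup : Subgroup (absoluteGaloisGroup F)) E.openNormalSubgroup :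
                Subgroup (L.openNormalSubgroup : Subgroup (absoluteGaloisGroup F)))
              ((resD ℤ (L.openNormalSubgroup : Subgroup (absoluteGaloisGroup F))).obj (classData F).toSystem.toD) φ) 2
            (groupCohomology.δ (Bockstein.intModShortComplex_shortExact
              ((L.openNormalSubgroup : Subgroup (absoluteGaloisGroup F)) ⧸
                (traceOpenNormalSubgroup (L.openNormalSubgroup : Subgroup (absoluteGaloisGroup F)) E.openNormalSubgroup :
                  Subgroup (L.openNormalSubgroup : Subgroup (absoluteGaloisGroup F)))) m) 1 2 rfl χ))) := by
  haveI : NeZero m := ⟨hm.ne'⟩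
  haveI := L.numberField
  by_cases hLE : L = E
  · -- the degenerate layer: `χ = 0`
    have hχ := traceLayer_class_eq_zero_of_eq h hLE χ
    subst hχ
    simp only [map_zero, inflTriv_zero]
  · letI := GalLayer.algebraOfLE h
    haveI := GalLayer.isScalarTower_of_le h
    haveI := E.finiteDimensional
    haveI : FiniteDimensional L.1 E.1 := Module.Finite.of_restrictScalars_finite F L.1 E.1
    haveI := E.isGalois
    haveI : IsGalois L.1 E.1 := IsGalois.tower_top_of_isGalois F L.1 E.1
    -- factor the character `χ ∘ g` of `Gal(E/L)` through an abelian `K ⊆ L̄` embedded in `E` (`Exists.elim`, not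
    -- `obtain`: casing the existential against this goal is prohibitively slow)
    have hex := exists_isAbelianGalois_character_factor (L := L.1) (E := E.1) (Ω := AlgebraicClosure L.1)
      (galCharacter h χ)
    refine hex.elim fun K h₁ => h₁.elim fun hK h₂ => h₂.elim fun hab h₃ => h₃.elim fun ψ h₄ => h₄.elim fun χK hfac => ?_
    clear h₁ h₂ h₃ h₄ hex
    -- the class of `χ` is the class of `(K, χ_K)` through `ψ`, and also through the chosen embedding `ψof K`
    have h1 := inflTriv_eq_layerCharClass h ψ χK χ hfac
    have h2 : layerCharClass h ψ χK = layerCharClass (hMof K hK) (ψof K hK) χK :=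
      layerCharClass_eq_of_forall_absRestrictNormalHom h (hMof K hK) K K ψ (ψof K hK) χK χK fun _ => rfl
    rw [h1, h2, hΨ K hK hab χK]
    exact classInvAll_baseCup_eq_layerValue_of_factor h hLE hm φ x₀ hx₀ χ K hK hab ψ χK hfac

set_option maxHeartbeats 800000 in
-- the big unfolded layer terms
/-- **Milne's (b) for `(U_L, Res C̄)`, surjectivity side.**  For every additive `Ψ : Ext¹_{C_{U_L}}(ℤ, ℤ/m) → ℚ/ℤ`
there is a morphism `φ : ℤ → Res_{U_L} C̄` (an idèle class `x̄₀ ∈ C_L = C̄^{U_L}`) with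
`Ψ (inflTriv (E⁻¹ χ)) = inv_U (Inf (H²(id, φ_V) (β_m χ)))` for every layer `E ⊇ L` and every
`χ ∈ H¹(U_L ⧸ (U_E ∩ U_L), ℤ/m)` — the hypothesis `Hsurj` of door-c4 g16's `adjointSurjective_triv_zmod_of_cofinal` on
the trace layers.  (The functional `Φ_K χ_K := −m·Ψ(layerCharClass)` on the characters of the finite abelian
`K ⊆ L̄` is additive and compatible under THE restrictions `Γ_L → Gal(K/L)` (`absRestrictNormalHom_absGalEquiv`), so
door-c6 g14's `exists_idele_forall_layer_pairing_eq` — global class field theory: reciprocity and the existence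
theorem — supplies the idèle `x₀`; then `apply_inflTriv_eq_layerValue`.) [cite: MilneADT2006, I Theorem 1.8 (b)]
[cite: CasselsFrohlichANT1967, Ch. VII §11.3, §5.1 Main Theorem (D)][cite: Neukirch2013, Part III Thm. (7.12)] -/
theorem exists_hom_forall_layer_value_eq (L : GalLayer F) {m : ℕ} (hm : 0 < m)
    (Ψ : Ext (triv (k := ℤ) (Γ := (L.openNormalSubgroup : Subgroup (absoluteGaloisGroup F))) ℤ)
      (triv (k := ℤ) (Γ := (L.openNormalSubgroup : Subgroup (absoluteGaloisGroup F))) (ZMod m)) 1 →+ AddCircle (1 : ℚ)) :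
    ∃ φ : triv (k := ℤ) (Γ := (L.openNormalSubgroup : Subgroup (absoluteGaloisGroup F))) ℤ ⟶
        (resD ℤ (L.openNormalSubgroup : Subgroup (absoluteGaloisGroup F))).obj (classData F).toSystem.toD,
      ∀ (E : GalLayer F) (_ : L ≤ E)
        (χ : groupCohomology (Rep.trivial ℤ ((L.openNormalSubgroup : Subgroup (absoluteGaloisGroup F)) ⧸
          (traceOpenNormalSubgroup (L.openNormalSubgroup : Subgroup (absoluteGaloisGroup F)) E.openNormalSubgroup :
            Subgroup (L.openNormalSubgroup : Subgroup (absoluteGaloisGroup F)))) (ZMod m)) 1),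
        haveI : NeZero m := ⟨hm.ne'⟩
        Ψ (inflTriv (traceOpenNormalSubgroup (L.openNormalSubgroup : Subgroup (absoluteGaloisGroup F))
                E.openNormalSubgroup : Subgroup (L.openNormalSubgroup : Subgroup (absoluteGaloisGroup F)))
              (LayerColimit.coe_isOpen _)
              ((RepExt.extTrivialAddEquivGroupCohomology (Rep.trivial ℤ _ (ZMod m)) 1).symm χ)) =
          classBarInvAt F (L.openNormalSubgroup : Subgroup (absoluteGaloisGroup F)) (LayerColimit.coe_isOpen _)
            (LayerColimit.inflG
              (traceOpenNormalSubgroup (L.openNormalSubgroup : Subgroup (absoluteGaloisGroup F)) E.openNormalSubgroup)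
              ((resD ℤ (L.openNormalSubgroup : Subgroup (absoluteGaloisGroup F))).obj (classData F).toSystem.toD) 2
              (groupCohomology.map (MonoidHom.id _)
                (LayerColimit.homToLayer
                  (traceOpenNormalSubgroup (L.openNormalSubgroup : Subgroup (absoluteGaloisGroup F))
                    E.openNormalSubgroup : Subgroup (L.openNormalSubgroup : Subgroup (absoluteGaloisGroup F)))
                  ((resD ℤ (L.openNormalSubgroup : Subgroup (absoluteGaloisGroup F))).obj (classData F).toSystem.toD)
                  φ) 2
                (groupCohomology.δ (Bockstein.intModShortComplex_shortExact
                  ((L.openNormalSubgroup : Subgroup (absoluteGaloisGroup F)) ⧸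
                    (traceOpenNormalSubgroup (L.openNormalSubgroup : Subgroup (absoluteGaloisGroup F))
                      E.openNormalSubgroup : Subgroup (L.openNormalSubgroup : Subgroup (absoluteGaloisGroup F)))) m)
                  1 2 rfl χ))) := by
  haveI : NeZero m := ⟨hm.ne'⟩
  haveI := L.numberField
  -- (1) a layer `Mof K ⊇ L` of `F̄` and an `L`-embedding `ψof K : K → Mof K` for every finite `K ⊆ L̄`
  have hex : ∀ (K : IntermediateField L.1 (AlgebraicClosure L.1)), FiniteDimensional L.1 K →
      ∃ (M : GalLayer F) (h : L ≤ M), Nonempty (letI := GalLayer.algebraOfLE h; K →ₐ[L.1] M.1) :=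
    fun K hK => by
      haveI := hK
      exact GalLayer.exists_ge_nonempty_algHom L K
  choose Mof hMof hψ using hex
  -- (2) the functional `Φ_K` on the characters of the finite Galois `K ⊆ L̄`: `Φ_K χ_K / m = -Ψ(layerCharClass)`
  have htors : ∀ (K : IntermediateField L.1 (AlgebraicClosure L.1)) (hK : FiniteDimensional L.1 K)
      (hG : IsGalois L.1 K) (χK : Additive (K ≃ₐ[L.1] K) →+ ZMod m),
      m • -Ψ (layerCharClass (hMof K hK) (hψ K hK).some χK) = 0 := fun K hK hG χK => by
    rw [smul_neg, nsmul_apply_layerCharClass_eq_zero, neg_zero]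
  have key : ∀ (K : IntermediateField L.1 (AlgebraicClosure L.1)) (χK : Additive (K ≃ₐ[L.1] K) →+ ZMod m),
      ∃ a : ZMod m, ∀ (hK : FiniteDimensional L.1 K) (hG : IsGalois L.1 K),
        zmodToQmodZ m a = -Ψ (layerCharClass (hMof K hK) (hψ K hK).some χK) := fun K χK => by
    by_cases hK : FiniteDimensional L.1 K
    · by_cases hG : IsGalois L.1 K
      · exact ⟨(exists_zmodToQmodZ_eq_of_nsmul_eq_zero m (htors K hK hG χK)).choose, fun _ _ =>
          (exists_zmodToQmodZ_eq_of_nsmul_eq_zero m (htors K hK hG χK)).choose_spec⟩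
      · exact ⟨0, fun _ hG' => (hG hG').elim⟩
    · exact ⟨0, fun hK' _ => (hK hK').elim⟩
  choose Φ hΦ using key
  have hadd : ∀ (K : IntermediateField L.1 (AlgebraicClosure L.1)) [FiniteDimensional L.1 K] [IsAbelianGalois L.1 K]
      (χ χ' : Additive (K ≃ₐ[L.1] K) →+ ZMod m), Φ K (χ + χ') = Φ K χ + Φ K χ' := by
    intro K hK hab χ χ'
    apply zmodToQmodZ_injective m
    rw [map_add, hΦ K _ hK hab.toIsGalois, hΦ K _ hK hab.toIsGalois, hΦ K _ hK hab.toIsGalois, layerCharClass_add,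
      map_add, neg_add]
  have hcompat : ∀ (K K' : IntermediateField L.1 (AlgebraicClosure L.1)) [FiniteDimensional L.1 K]
      [IsAbelianGalois L.1 K] [FiniteDimensional L.1 K'] [IsAbelianGalois L.1 K']
      (χ : Additive (K ≃ₐ[L.1] K) →+ ZMod m) (χ' : Additive (K' ≃ₐ[L.1] K') →+ ZMod m),
      (∀ γ : absoluteGaloisGroup L.1,
        χ (Additive.ofMul (absRestrictNormalHom K γ)) = χ' (Additive.ofMul (absRestrictNormalHom K' γ))) →
      Φ K χ = Φ K' χ' := by
    intro K K' hK hab hK' hab' χ χ' hγ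
    apply zmodToQmodZ_injective m
    rw [hΦ K χ hK hab.toIsGalois, hΦ K' χ' hK' hab'.toIsGalois,
      layerCharClass_eq_of_forall_absRestrictNormalHom (hMof K hK) (hMof K' hK') K K' (hψ K hK).some (hψ K' hK').some
        χ χ' hγ]
  -- (3) the idèle (door-c6 g14: reciprocity + the existence theorem over the base `L`; `Exists.elim`, not `obtain`:
  -- casing the existential against this goal is prohibitively slow)
  refine (IdeleCohomology.exists_idele_forall_layer_pairing_eq (F := L.1) hm Φ hadd hcompat).elim fun x₀ hx₀ => ?_
  -- (4) the invariant vector `φ` of the class `x̄₀ ∈ C_L = C̄^{U_L}`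
  have hcinv : ofLayer F L (Additive.ofMul (x₀ : IdeleClassGroup L.1)) ∈
      ((resD ℤ (L.openNormalSubgroup : Subgroup (absoluteGaloisGroup F))).obj (classData F).toSystem.toD).obj.ρ.invariants :=
    ((classData F).mem_invariants_iff L _).2 ⟨Additive.ofMul (x₀ : IdeleClassGroup L.1), rfl⟩
  have hφ : ofLayer F L (Additive.ofMul (x₀ : IdeleClassGroup L.1)) =
      ((homTrivEquiv ((resD ℤ (L.openNormalSubgroup : Subgroup (absoluteGaloisGroup F))).obj
        (classData F).toSystem.toD) ℤ).symm (LinearMap.toSpanSingleton ℤ _ ⟨_, hcinv⟩)).hom.hom (1 : ℤ) := by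
    have h1 := homTrivEquiv_apply_coe _ ℤ ((homTrivEquiv ((resD ℤ (L.openNormalSubgroup : Subgroup
      (absoluteGaloisGroup F))).obj (classData F).toSystem.toD) ℤ).symm (LinearMap.toSpanSingleton ℤ _ ⟨_, hcinv⟩)) 1
    rw [AddEquiv.apply_symm_apply, LinearMap.toSpanSingleton_apply_one] at h1
    exact h1
  refine ⟨(homTrivEquiv _ ℤ).symm (LinearMap.toSpanSingleton ℤ _ ⟨_, hcinv⟩), fun E h χ => ?_⟩
  -- the arithmetic input on the abelian layers: `Ψ(layerCharClass) = inv_{K/L}(ι[x₀] ∪ β_m[χ_K])` (term-mode `Eq.trans`: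
  -- rewriting inside door-c6's statement is prohibitively slow)
  exact apply_inflTriv_eq_layerValue h hm Ψ _ x₀ hφ Mof hMof (fun K hK => (hψ K hK).some)
    (fun K hK hab χK => neg_injective ((hΦ K χK hK hab.toIsGalois).symm.trans (hx₀ K hK hab χK))) χ

end IdeleClassBar

end Literature.NumberTheory.GaloisRepresentations

end
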